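import Literature.Barriers.CriticalPhenomena.LaceExpansionIsingDeconvolutionParts
import Literature.Barriers.CriticalPhenomena.LaceExpansionIsingDeconvolutionProofs
import Literature.Barriers.CriticalPhenomena.LaceExpansionIsingExpansionBounds
import Literature.Barriers.CriticalPhenomena.GaussianDominationRouteNobleProofs
import Mathlib.Analysis.Normed.Ring.InfiniteSum
import HarnessLib

/-!
# The convolution algebra `ℓ¹(ℤ^d)` for signed functions and the weighted norm of
# Liu–Slade's Proposition 4.1

Barrier catalogue `Literature/Barriers/CriticalPhenomena/` (D-0021), first of the two proof files
behind the named fact `SpreadOutIsing.LiuSlade2026_prop41` of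
`LaceExpansionIsingDeconvolutionParts.lean` (Liu–Slade 2026, Proposition 4.1: the Banach-algebra
reduction of the inhomogeneous convolution equation `H = h + zD*h*H` to the impulse equation
`F*H = δ`). The printed proof (§4 of the source) runs in the Banach algebra of functions
`v : ℤ^d → ℝ` with the norm
`‖v‖_ζ = max{2^{ζ+1} Σ_x |v(x)|, sup_x |x|^ζ |v(x)|}` ("Then `‖u*v‖_ζ ≤ ‖u‖_ζ‖v‖_ζ` for all `u`
and `v`, so the space `{v : ‖v‖_ζ < ∞}` is a Banach algebra with product given by convolution",
citing [BHK18]). This file supplies, for the tree's `tsum` convolution `latticeConv`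
(`LaceExpansionIsingDeconvolution.lean`) on SIGNED absolutely summable functions:

* the algebra: commutativity (free), the unit `δ`, linearity in either slot, absolute
  summability of `u*v` with `Σ|u*v| ≤ Σ|u| Σ|v|`, the `ℓ¹ × ℓ^∞` bound, and associativity
  `(a*b)*H = a*(b*H)` for `a, b ∈ ℓ¹` and `H` bounded (Fubini on `ℤ^d × ℤ^d`);
* `ℤ^d`-symmetry of `u*v` and of `f^{*n}` for symmetric data;
* the submultiplicativity of `‖·‖_ζ`, in the unbundled form "`Σ|v|` summable,
  `2^{ζ+1}Σ|v| ≤ M`, `|x|^ζ|v(x)| ≤ M` for all `x`" (no norm object is introduced): from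
  `|x| ≤ 2(|y| ∨ |x-y|)`, `|x|^ζ|(u*v)(x)| ≤ 2^ζ(B_u Σ|v| + Σ|u| B_v)`, whence the bound `M_u M_v`
  for `u*v` and `M^n` for `f^{*n}`, `n ≥ 1`; and the plain `ℓ¹` bound `Σ|f^{*n}| ≤ (Σ|f|)^n`.

The Neumann series, the deconvolution `h⁻¹` and the proof of Proposition 4.1 are in
`LaceExpansionIsingDeconvolutionPartsProofs.lean`.

## References

* Y. Liu, G. Slade, *Gaussian deconvolution and the lace expansion for spread-out models*,
  Ann. Inst. H. Poincaré Probab. Statist. (2026), arXiv:2310.07640: §4, the norm (4.4) and the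
  sentence following it [LiuSlade2026].
-/

noncomputable section

namespace Literature.Barriers.CriticalPhenomena.SpreadOutIsing

open Filter Literature.Probability.LatticeModels
open _root_.Topology

variable {d : ℕ}

/-! ## Part 1. `ℓ¹` lemmas for real families -/

/-- `|Σ_i F(i)| ≤ Σ_i |F(i)|` for an absolutely summable real family. [folklore] -/
theorem abs_tsum_le_tsum_abs {ι : Type*} {F : ι → ℝ} (hF : Summable fun i => |F i|) :
    |∑' i, F i| ≤ ∑' i, |F i| := by
  have h := norm_tsum_le_tsum_norm (f := F) (by simpa [Real.norm_eq_abs] using hF)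
  simpa [Real.norm_eq_abs] using h

/-- An absolutely summable function is bounded by its `ℓ¹` norm. [folklore] -/
theorem abs_le_tsum_abs {f : Site d → ℝ} (hf : Summable fun x => |f x|) (x : Site d) :
    |f x| ≤ ∑' y, |f y| :=
  hf.le_tsum x fun _ _ => abs_nonneg _

/-- `Σ_y |v(x - y)| = Σ_y |v(y)|`. [folklore] -/
theorem tsum_abs_comp_sub_left (v : Site d → ℝ) (x : Site d) :
    ∑' y, |v (x - y)| = ∑' y, |v y| :=
  (Equiv.subLeft x).tsum_eq fun y => |v y|

/-- `y ↦ |v(x - y)|` is summable when `|v|` is. [folklore] -/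
theorem summable_abs_comp_sub_left {v : Site d → ℝ} (hv : Summable fun x => |v x|) (x : Site d) :
    Summable fun y => |v (x - y)| :=
  (Equiv.subLeft x).summable_iff.2 hv

/-- `Σ_x |δ(x)| = 1`. [folklore] -/
theorem tsum_abs_delta0 : ∑' x : Site d, |delta0 x| = 1 := by
  rw [tsum_congr fun x => abs_of_nonneg (delta0_nonneg x)]
  exact hasSum_delta0.tsum_eq

/-- `⟦x⟧ = |x|` for `x ≠ 0` (`|x| ≥ 1` off the origin, `one_le_euclidNorm_of_ne_zero` of
`LaceExpansionIsingAboveFour.lean`). [folklore] -/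
theorem jnorm_of_ne_zero {x : Site d} (hx : x ≠ 0) : jnorm x = euclidNorm x :=
  jnorm_eq_euclidNorm (one_le_euclidNorm_of_ne_zero hx)

/-! ## Part 2. The convolution algebra -/

section Algebra

variable {f g a b u v H : Site d → ℝ}

/-- **Commutativity** `f * g = g * f` (the substitution `y ↦ x - y`; no summability is needed,
both sides being the same `tsum` up to a bijection of `ℤ^d`). [folklore] -/
theorem latticeConv_comm (f g : Site d → ℝ) (x : Site d) : latticeConv f g x = latticeConv g f x := by
  unfold latticeConv
  rw [← (Equiv.subLeft x).tsum_eq fun y => g y * f (x - y)]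
  refine tsum_congr fun y => ?_
  simp only [Equiv.subLeft_apply, sub_sub_cancel]
  ring

/-- `δ * f = f`. [folklore] -/
theorem latticeConv_delta0_left (f : Site d → ℝ) (x : Site d) : latticeConv delta0 f x = f x := by
  rw [latticeConv_comm, latticeConv_delta0]

/-- `f^{*1} = f` (general `f`; the tree's `convPow_one` is the instance `f = D`). [folklore] -/
theorem convPow_one_eq (f : Site d → ℝ) : convPow f 1 = f :=
  funext fun x => latticeConv_delta0_left f x

/-- `f^{*(n+1)} = f^{*n} * f`. [folklore] -/
theorem convPow_succ (f : Site d → ℝ) (n : ℕ) : convPow f (n + 1) = latticeConv (convPow f n) f := rfl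

/-- The terms of `(f * g)(x)` are summable for `f ∈ ℓ¹` and `g` bounded. [folklore] -/
theorem summable_latticeConv_term_of_bdd (hf : Summable fun x => |f x|) {M : ℝ}
    (hg : ∀ x, |g x| ≤ M) (x : Site d) : Summable fun y => f y * g (x - y) := by
  refine Summable.of_norm_bounded (hf.mul_right M) fun y => ?_
  rw [Real.norm_eq_abs, abs_mul]
  exact mul_le_mul_of_nonneg_left (hg _) (abs_nonneg _)

/-- **`ℓ¹ × ℓ^∞` bound**: `|(f * g)(x)| ≤ (Σ|f|) M` for `|g| ≤ M`. [folklore] -/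
theorem abs_latticeConv_le_of_bdd (hf : Summable fun x => |f x|) {M : ℝ} (hg : ∀ x, |g x| ≤ M)
    (x : Site d) : |latticeConv f g x| ≤ (∑' y, |f y|) * M := by
  unfold latticeConv
  have hs : Summable fun y => |f y * g (x - y)| := by
    refine Summable.of_nonneg_of_le (fun y => abs_nonneg _) (fun y => ?_) (hf.mul_right M)
    rw [abs_mul]
    exact mul_le_mul_of_nonneg_left (hg _) (abs_nonneg _)
  calc |∑' y, f y * g (x - y)| ≤ ∑' y, |f y * g (x - y)| := abs_tsum_le_tsum_abs hs
    _ ≤ ∑' y, |f y| * M :=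
        hs.tsum_le_tsum (fun y => by rw [abs_mul]; exact mul_le_mul_of_nonneg_left (hg _) (abs_nonneg _))
          (hf.mul_right M)
    _ = (∑' y, |f y|) * M := tsum_mul_right

/-- The terms of `(f * g)(x)` are summable for `f` bounded and `g ∈ ℓ¹`. [folklore] -/
theorem summable_latticeConv_term_of_bdd_left {M : ℝ} (hf : ∀ x, |f x| ≤ M)
    (hg : Summable fun x => |g x|) (x : Site d) : Summable fun y => f y * g (x - y) := by
  refine Summable.of_norm_bounded ((summable_abs_comp_sub_left hg x).mul_left M) fun y => ?_
  rw [Real.norm_eq_abs, abs_mul]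
  exact mul_le_mul_of_nonneg_right (hf _) (abs_nonneg _)

/-- The convolution family `(x, y) ↦ f(y) g(x - y)` is summable on `ℤ^d × ℤ^d` for
`f, g ∈ ℓ¹`. [folklore] -/
theorem summable_latticeConv_family_of_abs (hf : Summable fun x => |f x|)
    (hg : Summable fun x => |g x|) :
    Summable fun xy : Site d × Site d => f xy.2 * g (xy.1 - xy.2) := by
  refine Summable.of_norm_bounded
    (summable_latticeConv_family hf hg (fun _ => abs_nonneg _) fun _ => abs_nonneg _) fun xy => ?_
  rw [Real.norm_eq_abs, abs_mul]

/-- `|(f * g)(x)| ≤ (|f| * |g|)(x)` for `f, g ∈ ℓ¹`. [folklore] -/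
theorem abs_latticeConv_le_latticeConv_abs (hf : Summable fun x => |f x|)
    (hg : Summable fun x => |g x|) (x : Site d) :
    |latticeConv f g x| ≤ latticeConv (fun y => |f y|) (fun y => |g y|) x := by
  unfold latticeConv
  have hin := summable_latticeConv_inner hf hg (fun _ => abs_nonneg _) (fun _ => abs_nonneg _) x
  have hs : Summable fun y => |f y * g (x - y)| := hin.congr fun y => (abs_mul _ _).symm
  calc |∑' y, f y * g (x - y)| ≤ ∑' y, |f y * g (x - y)| := abs_tsum_le_tsum_abs hs
    _ = ∑' y, |f y| * |g (x - y)| := tsum_congr fun y => abs_mul _ _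

/-- **`ℓ¹ * ℓ¹ ⊆ ℓ¹`**: `f * g` is absolutely summable for `f, g ∈ ℓ¹`. [folklore] -/
theorem summable_abs_latticeConv (hf : Summable fun x => |f x|) (hg : Summable fun x => |g x|) :
    Summable fun x => |latticeConv f g x| :=
  Summable.of_nonneg_of_le (fun _ => abs_nonneg _) (abs_latticeConv_le_latticeConv_abs hf hg)
    (summable_latticeConv hf hg (fun _ => abs_nonneg _) fun _ => abs_nonneg _)

/-- **`Σ|f * g| ≤ Σ|f| Σ|g|`**. [folklore] -/
theorem tsum_abs_latticeConv_le (hf : Summable fun x => |f x|) (hg : Summable fun x => |g x|) :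
    ∑' x, |latticeConv f g x| ≤ (∑' x, |f x|) * ∑' x, |g x| := by
  calc ∑' x, |latticeConv f g x| ≤ ∑' x, latticeConv (fun y => |f y|) (fun y => |g y|) x :=
        (summable_abs_latticeConv hf hg).tsum_le_tsum (abs_latticeConv_le_latticeConv_abs hf hg)
          (summable_latticeConv hf hg (fun _ => abs_nonneg _) fun _ => abs_nonneg _)
    _ = (∑' x, |f x|) * ∑' x, |g x| :=
        tsum_latticeConv hf hg (fun _ => abs_nonneg _) fun _ => abs_nonneg _

/-- Linearity in the right slot: `f * (g₁ + c g₂) = f * g₁ + c (f * g₂)` at `x`, given the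
summability of the two term families. [folklore] -/
theorem latticeConv_add_smul_right {g₁ g₂ : Site d → ℝ} (c : ℝ) {x : Site d}
    (h₁ : Summable fun y => f y * g₁ (x - y)) (h₂ : Summable fun y => f y * g₂ (x - y)) :
    latticeConv f (fun y => g₁ y + c * g₂ y) x = latticeConv f g₁ x + c * latticeConv f g₂ x := by
  unfold latticeConv
  rw [← tsum_mul_left, ← h₁.tsum_add (h₂.mul_left c)]
  exact tsum_congr fun y => by ring

/-- Linearity in the left slot: `(f₁ - c f₂) * g = f₁ * g - c (f₂ * g)` at `x`, given the
summability of the two term families. [folklore] -/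
theorem latticeConv_sub_smul_left {f₁ f₂ : Site d → ℝ} (c : ℝ) {x : Site d}
    (h₁ : Summable fun y => f₁ y * g (x - y)) (h₂ : Summable fun y => f₂ y * g (x - y)) :
    latticeConv (fun y => f₁ y - c * f₂ y) g x = latticeConv f₁ g x - c * latticeConv f₂ g x := by
  unfold latticeConv
  rw [← tsum_mul_left, ← h₁.tsum_sub (h₂.mul_left c)]
  exact tsum_congr fun y => by ring

/-- Linearity in the left slot: `(f₁ + c f₂) * g = f₁ * g + c (f₂ * g)` at `x`. [folklore] -/
theorem latticeConv_add_smul_left {f₁ f₂ : Site d → ℝ} (c : ℝ) {x : Site d}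
    (h₁ : Summable fun y => f₁ y * g (x - y)) (h₂ : Summable fun y => f₂ y * g (x - y)) :
    latticeConv (fun y => f₁ y + c * f₂ y) g x = latticeConv f₁ g x + c * latticeConv f₂ g x := by
  unfold latticeConv
  rw [← tsum_mul_left, ← h₁.tsum_add (h₂.mul_left c)]
  exact tsum_congr fun y => by ring

/-- **Associativity with a bounded third factor**: `(a * b) * H = a * (b * H)` for `a, b ∈ ℓ¹`
and `H` bounded (Fubini for the absolutely summable family `(u, y) ↦ a(u) b(y-u) H(x-y)` on
`ℤ^d × ℤ^d`). [folklore] -/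
theorem latticeConv_assoc_of_bdd (ha : Summable fun x => |a x|) (hb : Summable fun x => |b x|)
    {M : ℝ} (hH : ∀ x, |H x| ≤ M) (x : Site d) :
    latticeConv (latticeConv a b) H x = latticeConv a (latticeConv b H) x := by
  -- the family `G u y = a u * b (y - u) * H (x - y)` is summable on `ℤ^d × ℤ^d`
  set G : Site d → Site d → ℝ := fun u y => a u * b (y - u) * H (x - y) with hG
  have hfam : Summable (Function.uncurry G) := by
    have h1 : Summable fun yu : Site d × Site d => |a yu.2| * |b (yu.1 - yu.2)| :=
      summable_latticeConv_family ha hb (fun _ => abs_nonneg _) fun _ => abs_nonneg _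
    have h2 : Summable fun uy : Site d × Site d => |a uy.1| * |b (uy.2 - uy.1)| * M := by
      have := ((Equiv.prodComm (Site d) (Site d)).summable_iff.2 h1).mul_right M
      refine this.congr fun uy => ?_
      simp
    refine Summable.of_norm_bounded h2 fun uy => ?_
    obtain ⟨u, y⟩ := uy
    rw [Function.uncurry_apply_pair, hG, Real.norm_eq_abs, abs_mul, abs_mul]
    exact mul_le_mul_of_nonneg_left (hH _) (mul_nonneg (abs_nonneg _) (abs_nonneg _))
  -- inner summability in `u` for fixed `y` (sections of a summable family)
  have hsec : ∀ y, Summable fun u => a u * b (y - u) * H (x - y) := fun y =>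
    hfam.prod_symm.prod_factor y
  calc latticeConv (latticeConv a b) H x
      = ∑' y, ∑' u, a u * b (y - u) * H (x - y) := by
        unfold latticeConv
        exact tsum_congr fun y => by rw [← tsum_mul_right]
    _ = ∑' u, ∑' y, a u * b (y - u) * H (x - y) := hfam.tsum_comm
    _ = ∑' u, a u * ∑' y, b (y - u) * H (x - y) := by
        refine tsum_congr fun u => ?_
        rw [← tsum_mul_left]
        exact tsum_congr fun y => by ring
    _ = ∑' u, a u * latticeConv b H (x - u) := by
        refine tsum_congr fun u => ?_
        congr 1
        unfold latticeConv
        rw [← (Equiv.addRight u).tsum_eq fun y => b (y - u) * H (x - y)]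
        refine tsum_congr fun v => ?_
        simp only [Equiv.coe_addRight, add_sub_cancel_right]
        congr 2
        abel
    _ = latticeConv a (latticeConv b H) x := rfl

/-- **Symmetry**: the convolution of `ℤ^d`-symmetric functions is `ℤ^d`-symmetric (signed
coordinate permutations are additive bijections of `ℤ^d`). [folklore] -/
theorem isZdSymmetric_latticeConv (hu : IsZdSymmetric u) (hv : IsZdSymmetric v) :
    IsZdSymmetric (latticeConv u v) := by
  intro π ε x
  unfold latticeConv
  rw [← Equiv.tsum_eq (Site.signedPerm π ε) fun y => u y * v (Site.signedPerm π ε x - y)]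
  refine tsum_congr fun y => ?_
  show u (Site.signedPerm π ε y) * v (Site.signedPerm π ε x - Site.signedPerm π ε y) = u y * v (x - y)
  rw [hu π ε y, ← signedPerm_sub, hv π ε (x - y)]

/-- The convolution powers of a `ℤ^d`-symmetric function are `ℤ^d`-symmetric. [folklore] -/
theorem isZdSymmetric_convPow (hf : IsZdSymmetric f) : ∀ n : ℕ, IsZdSymmetric (convPow f n)
  | 0 => isZdSymmetric_delta0
  | n + 1 => isZdSymmetric_latticeConv (isZdSymmetric_convPow hf n) hf

end Algebra

/-! ## Part 3. The weighted norm `‖v‖_ζ = max{2^{ζ+1}Σ|v|, sup |x|^ζ|v(x)|}`: submultiplicativity -/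

section Norm

variable {f u v : Site d → ℝ} {ζ : ℝ}

/-- `|x|^ζ ≤ 2^ζ (|y|^ζ + |x - y|^ζ)` (`|x| ≤ |y| + |x-y| ≤ 2(|y| ∨ |x-y|)`), `ζ ≥ 0`. [folklore] -/
theorem euclidNorm_rpow_le_split (hζ : 0 ≤ ζ) (x y : Site d) :
    euclidNorm x ^ ζ ≤ 2 ^ ζ * (euclidNorm y ^ ζ + euclidNorm (x - y) ^ ζ) := by
  have htri : euclidNorm x ≤ euclidNorm y + euclidNorm (x - y) := by
    have h := euclidNorm_add_le y (x - y)
    rwa [show y + (x - y) = x by abel] at h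
  have h0y : 0 ≤ euclidNorm y ^ ζ := Real.rpow_nonneg (euclidNorm_nonneg _) _
  have h0xy : 0 ≤ euclidNorm (x - y) ^ ζ := Real.rpow_nonneg (euclidNorm_nonneg _) _
  have h2 : 0 ≤ (2 : ℝ) ^ ζ := by positivity
  rcases le_total (euclidNorm y) (euclidNorm (x - y)) with h | h
  · have hx : euclidNorm x ≤ 2 * euclidNorm (x - y) := by linarith
    calc euclidNorm x ^ ζ ≤ (2 * euclidNorm (x - y)) ^ ζ :=
          Real.rpow_le_rpow (euclidNorm_nonneg x) hx hζ
      _ = 2 ^ ζ * euclidNorm (x - y) ^ ζ := Real.mul_rpow (by norm_num) (euclidNorm_nonneg _)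
      _ ≤ 2 ^ ζ * (euclidNorm y ^ ζ + euclidNorm (x - y) ^ ζ) := by nlinarith
  · have hx : euclidNorm x ≤ 2 * euclidNorm y := by linarith
    calc euclidNorm x ^ ζ ≤ (2 * euclidNorm y) ^ ζ :=
          Real.rpow_le_rpow (euclidNorm_nonneg x) hx hζ
      _ = 2 ^ ζ * euclidNorm y ^ ζ := Real.mul_rpow (by norm_num) (euclidNorm_nonneg _)
      _ ≤ 2 ^ ζ * (euclidNorm y ^ ζ + euclidNorm (x - y) ^ ζ) := by nlinarith

/-- **The weighted-sup estimate** behind `‖u*v‖_ζ ≤ ‖u‖_ζ‖v‖_ζ`: if `|y|^ζ|u(y)| ≤ B_u` and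
`|y|^ζ|v(y)| ≤ B_v` for all `y` (`u, v ∈ ℓ¹`), then
`|x|^ζ |(u*v)(x)| ≤ 2^ζ (B_u Σ|v| + Σ|u| B_v)`. [cite: LiuSlade2026, §4 ((4.4) and the sentence following it)] -/
theorem rpow_mul_abs_latticeConv_le (hζ : 0 ≤ ζ) (hu : Summable fun x => |u x|)
    (hv : Summable fun x => |v x|) {Bu Bv : ℝ} (hBu : ∀ y, euclidNorm y ^ ζ * |u y| ≤ Bu)
    (hBv : ∀ y, euclidNorm y ^ ζ * |v y| ≤ Bv) (x : Site d) :
    euclidNorm x ^ ζ * |latticeConv u v x| ≤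
      2 ^ ζ * (Bu * ∑' y, |v y| + (∑' y, |u y|) * Bv) := by
  have hin : Summable fun y => |u y| * |v (x - y)| :=
    summable_latticeConv_inner hu hv (fun _ => abs_nonneg _) (fun _ => abs_nonneg _) x
  have hvx : Summable fun y => |v (x - y)| := summable_abs_comp_sub_left hv x
  have hBu0 : 0 ≤ Bu := le_trans (mul_nonneg (Real.rpow_nonneg (euclidNorm_nonneg _) _)
    (abs_nonneg _)) (hBu 0)
  have hBv0 : 0 ≤ Bv := le_trans (mul_nonneg (Real.rpow_nonneg (euclidNorm_nonneg _) _)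
    (abs_nonneg _)) (hBv 0)
  -- the two dominating families
  have h1 : Summable fun y => euclidNorm y ^ ζ * |u y| * |v (x - y)| :=
    Summable.of_nonneg_of_le
      (fun y => mul_nonneg (mul_nonneg (Real.rpow_nonneg (euclidNorm_nonneg _) _) (abs_nonneg _))
        (abs_nonneg _))
      (fun y => mul_le_mul_of_nonneg_right (hBu y) (abs_nonneg _)) (hvx.mul_left Bu)
  have h2 : Summable fun y => |u y| * (euclidNorm (x - y) ^ ζ * |v (x - y)|) :=
    Summable.of_nonneg_of_le
      (fun y => mul_nonneg (abs_nonneg _) (mul_nonneg (Real.rpow_nonneg (euclidNorm_nonneg _) _)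
        (abs_nonneg _)))
      (fun y => mul_le_mul_of_nonneg_left (hBv (x - y)) (abs_nonneg _)) (hu.mul_right Bv)
  have hxpow : 0 ≤ euclidNorm x ^ ζ := Real.rpow_nonneg (euclidNorm_nonneg _) _
  calc euclidNorm x ^ ζ * |latticeConv u v x|
      ≤ euclidNorm x ^ ζ * ∑' y, |u y| * |v (x - y)| :=
        mul_le_mul_of_nonneg_left (abs_latticeConv_le_latticeConv_abs hu hv x) hxpow
    _ = ∑' y, euclidNorm x ^ ζ * (|u y| * |v (x - y)|) := tsum_mul_left.symm
    _ ≤ ∑' y, 2 ^ ζ * (euclidNorm y ^ ζ * |u y| * |v (x - y)| +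
          |u y| * (euclidNorm (x - y) ^ ζ * |v (x - y)|)) := by
        refine (hin.mul_left _).tsum_le_tsum (fun y => ?_) ((h1.add h2).mul_left _)
        have huv : 0 ≤ |u y| * |v (x - y)| := mul_nonneg (abs_nonneg _) (abs_nonneg _)
        calc euclidNorm x ^ ζ * (|u y| * |v (x - y)|)
            ≤ 2 ^ ζ * (euclidNorm y ^ ζ + euclidNorm (x - y) ^ ζ) * (|u y| * |v (x - y)|) :=
              mul_le_mul_of_nonneg_right (euclidNorm_rpow_le_split hζ x y) huv
          _ = _ := by ring
    _ = 2 ^ ζ * (∑' y, euclidNorm y ^ ζ * |u y| * |v (x - y)| +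
          ∑' y, |u y| * (euclidNorm (x - y) ^ ζ * |v (x - y)|)) := by
        rw [tsum_mul_left, h1.tsum_add h2]
    _ ≤ 2 ^ ζ * (Bu * ∑' y, |v y| + (∑' y, |u y|) * Bv) := by
        gcongr
        · calc ∑' y, euclidNorm y ^ ζ * |u y| * |v (x - y)| ≤ ∑' y, Bu * |v (x - y)| :=
                h1.tsum_le_tsum (fun y => mul_le_mul_of_nonneg_right (hBu y) (abs_nonneg _))
                  (hvx.mul_left Bu)
            _ = Bu * ∑' y, |v y| := by rw [tsum_mul_left, tsum_abs_comp_sub_left]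
        · calc ∑' y, |u y| * (euclidNorm (x - y) ^ ζ * |v (x - y)|) ≤ ∑' y, |u y| * Bv :=
                h2.tsum_le_tsum (fun y => mul_le_mul_of_nonneg_left (hBv _) (abs_nonneg _))
                  (hu.mul_right Bv)
            _ = (∑' y, |u y|) * Bv := tsum_mul_right

/-- **Submultiplicativity of `‖·‖_ζ`** (Liu–Slade 2026, after (4.4): "`‖u*v‖_ζ ≤ ‖u‖_ζ‖v‖_ζ` for
all `u` and `v`"), unbundled: if `2^{ζ+1}Σ|u| ≤ M_u`, `|x|^ζ|u(x)| ≤ M_u` and likewise for `v`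
with `M_v`, then `u*v ∈ ℓ¹`, `2^{ζ+1}Σ|u*v| ≤ M_u M_v` and `|x|^ζ|(u*v)(x)| ≤ M_u M_v`.
[cite: LiuSlade2026, §4 ((4.4) and the sentence following it)] -/
theorem lsNorm_latticeConv_le (hζ : 0 ≤ ζ) (hu : Summable fun x => |u x|)
    (hv : Summable fun x => |v x|) {Mu Mv : ℝ} (hu1 : 2 ^ (ζ + 1) * ∑' x, |u x| ≤ Mu)
    (hu2 : ∀ x, euclidNorm x ^ ζ * |u x| ≤ Mu) (hv1 : 2 ^ (ζ + 1) * ∑' x, |v x| ≤ Mv)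
    (hv2 : ∀ x, euclidNorm x ^ ζ * |v x| ≤ Mv) :
    (Summable fun x => |latticeConv u v x|) ∧
      2 ^ (ζ + 1) * ∑' x, |latticeConv u v x| ≤ Mu * Mv ∧
      ∀ x, euclidNorm x ^ ζ * |latticeConv u v x| ≤ Mu * Mv := by
  have hMu0 : 0 ≤ Mu := le_trans (mul_nonneg (Real.rpow_nonneg (euclidNorm_nonneg _) _)
    (abs_nonneg _)) (hu2 0)
  have hMv0 : 0 ≤ Mv := le_trans (mul_nonneg (Real.rpow_nonneg (euclidNorm_nonneg _) _)
    (abs_nonneg _)) (hv2 0)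
  have h2pos : (0 : ℝ) < 2 ^ (ζ + 1) := by positivity
  have h2one : (1 : ℝ) ≤ 2 ^ (ζ + 1) := Real.one_le_rpow (by norm_num) (by linarith)
  have h2succ : (2 : ℝ) ^ (ζ + 1) = 2 ^ ζ * 2 := Real.rpow_add_one (by norm_num) ζ
  have hSu0 : 0 ≤ ∑' x, |u x| := tsum_nonneg fun _ => abs_nonneg _
  have hSv0 : 0 ≤ ∑' x, |v x| := tsum_nonneg fun _ => abs_nonneg _
  -- `Σ|u| ≤ Mu / 2^{ζ+1}` and `Σ|v| ≤ Mv / 2^{ζ+1} ≤ Mv`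
  have hSu : ∑' x, |u x| ≤ Mu / 2 ^ (ζ + 1) := by
    rw [le_div_iff₀ h2pos, mul_comm]; exact hu1
  have hSv : ∑' x, |v x| ≤ Mv / 2 ^ (ζ + 1) := by
    rw [le_div_iff₀ h2pos, mul_comm]; exact hv1
  have hSv' : ∑' x, |v x| ≤ Mv := hSv.trans (div_le_self hMv0 h2one)
  refine ⟨summable_abs_latticeConv hu hv, ?_, fun x => ?_⟩
  · calc 2 ^ (ζ + 1) * ∑' x, |latticeConv u v x|
        ≤ 2 ^ (ζ + 1) * ((∑' x, |u x|) * ∑' x, |v x|) :=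
          mul_le_mul_of_nonneg_left (tsum_abs_latticeConv_le hu hv) h2pos.le
      _ = (2 ^ (ζ + 1) * ∑' x, |u x|) * ∑' x, |v x| := by ring
      _ ≤ Mu * Mv := mul_le_mul hu1 hSv' hSv0 hMu0
  · calc euclidNorm x ^ ζ * |latticeConv u v x|
        ≤ 2 ^ ζ * (Mu * ∑' y, |v y| + (∑' y, |u y|) * Mv) :=
          rpow_mul_abs_latticeConv_le hζ hu hv hu2 hv2 x
      _ ≤ 2 ^ ζ * (Mu * (Mv / 2 ^ (ζ + 1)) + Mu / 2 ^ (ζ + 1) * Mv) := by gcongr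
      _ = Mu * Mv := by rw [h2succ]; field_simp; ring

/-- **`‖f^{*n}‖_ζ ≤ ‖f‖_ζ^n`** for `n ≥ 1`, unbundled. [cite: LiuSlade2026, §4 (Banach algebra; |f^{*n}(0)| ≤ ‖f^{*n}‖_ζ ≤ ‖f‖_ζ^n)] -/
theorem lsNorm_convPow_le (hζ : 0 ≤ ζ) (hf : Summable fun x => |f x|) {M : ℝ}
    (hf1 : 2 ^ (ζ + 1) * ∑' x, |f x| ≤ M) (hf2 : ∀ x, euclidNorm x ^ ζ * |f x| ≤ M) (n : ℕ)
    (hn : 1 ≤ n) :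
    (Summable fun x => |convPow f n x|) ∧
      2 ^ (ζ + 1) * ∑' x, |convPow f n x| ≤ M ^ n ∧
      ∀ x, euclidNorm x ^ ζ * |convPow f n x| ≤ M ^ n := by
  induction n, hn using Nat.le_induction with
  | base => rw [convPow_one_eq, pow_one]; exact ⟨hf, hf1, hf2⟩
  | succ n _ ih =>
    obtain ⟨h0, h1, h2⟩ := ih
    rw [convPow_succ, pow_succ]
    exact lsNorm_latticeConv_le hζ h0 hf h1 h2 hf1 hf2

/-- **`Σ|f^{*n}| ≤ (Σ|f|)^n`** (all `n`; `f^{*0} = δ`). [folklore] -/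
theorem tsum_abs_convPow_le (hf : Summable fun x => |f x|) :
    ∀ n : ℕ, (Summable fun x => |convPow f n x|) ∧ ∑' x, |convPow f n x| ≤ (∑' x, |f x|) ^ n
  | 0 => ⟨summable_abs_delta0, by rw [pow_zero]; exact (tsum_abs_delta0 (d := d)).le⟩
  | n + 1 => by
    obtain ⟨h0, h1⟩ := tsum_abs_convPow_le hf n
    refine ⟨summable_abs_latticeConv h0 hf, ?_⟩
    calc ∑' x, |convPow f (n + 1) x| ≤ (∑' x, |convPow f n x|) * ∑' x, |f x| :=
          tsum_abs_latticeConv_le h0 hf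
      _ ≤ (∑' x, |f x|) ^ n * ∑' x, |f x| :=
          mul_le_mul_of_nonneg_right h1 (tsum_nonneg fun _ => abs_nonneg _)
      _ = (∑' x, |f x|) ^ (n + 1) := (pow_succ _ _).symm

/-- Pointwise: `|f^{*n}(x)| ≤ (Σ|f|)^n`. [folklore] -/
theorem abs_convPow_le (hf : Summable fun x => |f x|) (n : ℕ) (x : Site d) :
    |convPow f n x| ≤ (∑' x, |f x|) ^ n :=
  (abs_le_tsum_abs (tsum_abs_convPow_le hf n).1 x).trans (tsum_abs_convPow_le hf n).2

end Norm

end Literature.Barriers.CriticalPhenomena.SpreadOutIsing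

end
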